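import Mathlib.Algebra.Polynomial.RingDivision
import Literature.Computability.AlgebraicComplexity.SchoenhageTau
import HarnessLib

/-!
# The tropical Brent prevariety: valuation patterns of approximate decompositions

Definition request D1 of route `MatrixMultiplication/TropicalBiniPatterns`. An order-`h` approximate
decomposition `∑_ρ u_ρ ⊗ v_ρ ⊗ w_ρ = εʰ t + O(ε^{h+1})` over `K[ε]`
(`Literature.Computability.AlgebraicComplexity.IsApproxDecomposition`, Bläser 2013 Def. 6.1) has a
**valuation pattern**: the `ε`-orders (trailing degrees, `⊤` for an identically zero coordinate) of
its `3r` vectors. In every cell `(a, b, c)` the Brent equation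
`∑_ρ u_ρ(a) v_ρ(b) w_ρ(c) = t_{abc} εʰ + O(ε^{h+1})` forces Kapranov's condition on these orders:
**the minimum `m = min_ρ (ord u_ρ(a) + ord v_ρ(b) + ord w_ρ(c))` is attained twice unless it is the
order `h` of a non-zero right-hand side, and `m ≤ h` when `t_{abc} ≠ 0`** — the easy ("only if")
direction of the fundamental theorem of tropical geometry applied to the polynomial
`∑_ρ x_ρ y_ρ z_ρ - t_{abc} εʰ` (Maclagan–Sturmfels, *Introduction to Tropical Geometry*, GSM 161,
Thm. 3.1.3: a point of the variety of `f = Σ c_u x^u` over a valued field lies in the tropical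
hypersurface, i.e. the minimum of `val(c_u) + u·w` is attained at least twice).

## Contents (all proved; no named facts)

* `ValuationPattern r ι κ μ` — `Fin r → (ι → ℕ∞) × (κ → ℕ∞) × (μ → ℕ∞)`; `patternVal W ρ a b c`
  (the order of the `ρ`-th product in the cell), `patternMin W a b c` (their minimum, `⊤` for `r = 0`).
* `IsTropicalBrentPattern h t W` — THE NOTION: in every cell, (i) if `m < h`, or `m = h` and
  `t a b c = 0`, the minimum is attained by two distinct `ρ`; (ii) if `t a b c ≠ 0` then `m ≤ h`.
* `trailingPattern u v w` — the pattern of trailing degrees of polynomial data, and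
  **`IsApproxDecomposition.isTropicalBrentPattern`** (the route's support item
  `TropicalBrentNecessary`): over a commutative semiring without zero divisors, the trailing pattern
  of every order-`h` approximate decomposition of `t` is a tropical Brent pattern.
* invariance: `IsTropicalBrentPattern.of_patternVal_eq` (any move preserving all cell values —
  per-term rescalings `(α_ρ + s, β_ρ + s', γ_ρ - s - s')` and isotropy-torus translations whenever
  they stay in `ℕ∞` are such moves), `IsTropicalBrentPattern.reindex` (relabelling the terms).

## References

* D. Maclagan, B. Sturmfels, *Introduction to Tropical Geometry*, GSM 161, AMS (2015), Thm. 3.1.3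
  (Kapranov's theorem; the inclusion `V(f) ⊆ trop(f)` is the elementary half). doi:10.1090/gsm/161.
* M. Bläser, *Fast Matrix Multiplication*, Theory of Computing Library, Graduate Surveys 5 (2013),
  Def. 6.1 (approximate decompositions). [`Blaser2013`]
-/

noncomputable section

open Polynomial Finset

namespace Literature.Computability.AlgebraicComplexity

universe u v₁ v₂ v₃

variable {K : Type u} {ι : Type v₁} {κ : Type v₂} {μ : Type v₃} {r : ℕ}

/-! ### Valuation patterns -/

/-- A **valuation pattern** for `r` triads: for each term `ρ < r` the would-be `ε`-orders of the
coordinates of `u_ρ`, `v_ρ`, `w_ρ` (`⊤` = identically zero coordinate). [folklore] -/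
abbrev ValuationPattern (r : ℕ) (ι : Type v₁) (κ : Type v₂) (μ : Type v₃) : Type (max v₁ v₂ v₃) :=
  Fin r → (ι → ℕ∞) × (κ → ℕ∞) × (μ → ℕ∞)

/-- The order of the `ρ`-th product in the cell `(a, b, c)`: `ord u_ρ(a) + ord v_ρ(b) + ord w_ρ(c)`. [folklore] -/
def patternVal (W : ValuationPattern r ι κ μ) (ρ : Fin r) (a : ι) (b : κ) (c : μ) : ℕ∞ :=
  (W ρ).1 a + (W ρ).2.1 b + (W ρ).2.2 c

/-- The minimal order `m = min_ρ patternVal W ρ a b c` in the cell `(a, b, c)` (`⊤` when `r = 0`). [folklore] -/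
def patternMin (W : ValuationPattern r ι κ μ) (a : ι) (b : κ) (c : μ) : ℕ∞ :=
  Finset.univ.inf fun ρ => patternVal W ρ a b c

/-- The minimum is a lower bound. [folklore] -/
theorem patternMin_le (W : ValuationPattern r ι κ μ) (ρ : Fin r) (a : ι) (b : κ) (c : μ) :
    patternMin W a b c ≤ patternVal W ρ a b c :=
  Finset.inf_le (Finset.mem_univ ρ)

/-- For `r ≠ 0` the minimum is attained. [folklore] -/
theorem exists_patternVal_eq_patternMin [NeZero r] (W : ValuationPattern r ι κ μ) (a : ι) (b : κ)
    (c : μ) : ∃ ρ, patternVal W ρ a b c = patternMin W a b c := by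
  obtain ⟨ρ, -, hρ⟩ := Finset.exists_mem_eq_inf (Finset.univ : Finset (Fin r)) Finset.univ_nonempty
    fun ρ => patternVal W ρ a b c
  exact ⟨ρ, hρ.symm⟩

/-! ### The tropical Brent prevariety -/

/-- **The tropical Brent pattern condition** (the tropical prevariety of the order-`h` Brent
equations for `t` with `r` terms, as a predicate on valuation patterns): in every cell `(a, b, c)`,
with `m = patternMin W a b c`,
(i) if `m < h`, or `m = h` and `t a b c = 0`, then the minimum is attained by two distinct terms
(the `εᵐ`-coefficients must cancel); (ii) if `t a b c ≠ 0` then `m ≤ h` (some term must produce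
`εʰ`) — Kapranov's "minimum attained twice" condition for `∑_ρ x_ρ y_ρ z_ρ - t_{abc} εʰ`
(Maclagan–Sturmfels, Thm. 3.1.3, elementary inclusion). [cite: MaclaganSturmfels2015, Thm. 3.1.3] -/
def IsTropicalBrentPattern (h : ℕ) (t : ι → κ → μ → K) [Zero K] (W : ValuationPattern r ι κ μ) : Prop :=
  ∀ (a : ι) (b : κ) (c : μ),
    ((patternMin W a b c < h ∨ (patternMin W a b c = h ∧ t a b c = 0)) →
        ∃ ρ ρ' : Fin r, ρ ≠ ρ' ∧ patternVal W ρ a b c = patternMin W a b c ∧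
          patternVal W ρ' a b c = patternMin W a b c) ∧
      (t a b c ≠ 0 → patternMin W a b c ≤ h)

namespace IsTropicalBrentPattern

variable [Zero K] {h : ℕ} {t : ι → κ → μ → K} {W W' : ValuationPattern r ι κ μ}

/-- **Invariance under value-preserving moves**: the condition only depends on the cell values
`patternVal W ρ a b c`; in particular per-term rescalings `(α_ρ + s, β_ρ + s', γ_ρ - s - s')` and
isotropy-torus translations preserve it whenever they keep all values in `ℕ∞` and unchanged. [folklore] -/
theorem of_patternVal_eq (hW : IsTropicalBrentPattern h t W)
    (heq : ∀ ρ a b c, patternVal W' ρ a b c = patternVal W ρ a b c) :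
    IsTropicalBrentPattern h t W' := by
  have hmin : ∀ a b c, patternMin W' a b c = patternMin W a b c := fun a b c => by
    unfold patternMin
    exact Finset.inf_congr rfl fun ρ _ => heq ρ a b c
  intro a b c
  obtain ⟨h1, h2⟩ := hW a b c
  refine ⟨fun hm => ?_, fun ht => ?_⟩
  · rw [hmin] at hm
    obtain ⟨ρ, ρ', hne, hρ, hρ'⟩ := h1 hm
    exact ⟨ρ, ρ', hne, by rw [heq, hmin, hρ], by rw [heq, hmin, hρ']⟩
  · rw [hmin]
    exact h2 ht

/-- **Relabelling the terms** preserves the condition. [folklore] -/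
theorem reindex (hW : IsTropicalBrentPattern h t W) (σ : Equiv.Perm (Fin r)) :
    IsTropicalBrentPattern h t (W ∘ σ) := by
  have hval : ∀ ρ a b c, patternVal (W ∘ σ) ρ a b c = patternVal W (σ ρ) a b c := fun _ _ _ _ => rfl
  have hmin : ∀ a b c, patternMin (W ∘ σ) a b c = patternMin W a b c := fun a b c => by
    unfold patternMin
    simp only [hval]
    exact le_antisymm
      (Finset.le_inf fun ρ _ => (Finset.inf_le (Finset.mem_univ (σ.symm ρ))).trans (by simp))
      (Finset.le_inf fun ρ _ => Finset.inf_le (Finset.mem_univ (σ ρ)))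
  intro a b c
  obtain ⟨h1, h2⟩ := hW a b c
  refine ⟨fun hm => ?_, fun ht => by rw [hmin]; exact h2 ht⟩
  rw [hmin] at hm
  obtain ⟨ρ, ρ', hne, hρ, hρ'⟩ := h1 hm
  refine ⟨σ.symm ρ, σ.symm ρ', fun h' => hne (σ.symm.injective h'), ?_, ?_⟩
  · rw [hval, Equiv.apply_symm_apply, hmin, hρ]
  · rw [hval, Equiv.apply_symm_apply, hmin, hρ']

end IsTropicalBrentPattern

/-! ### The pattern of an approximate decomposition -/

section Necessary

variable [CommSemiring K]

/-- **The trailing pattern** of polynomial data `(u, v, w)`: the trailing degrees (`ε`-orders,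
`⊤` for the zero polynomial) of all coordinates. [folklore] -/
def trailingPattern (u : Fin r → ι → K[X]) (v : Fin r → κ → K[X]) (w : Fin r → μ → K[X]) :
    ValuationPattern r ι κ μ :=
  fun ρ => (fun a => (u ρ a).trailingDegree, fun b => (v ρ b).trailingDegree,
    fun c => (w ρ c).trailingDegree)

/-- Without zero divisors, the cell value of the trailing pattern is the trailing degree of the
product `u_ρ(a) v_ρ(b) w_ρ(c)` (`trailingDegree_mul`). [folklore] -/
theorem patternVal_trailingPattern [NoZeroDivisors K] (u : Fin r → ι → K[X]) (v : Fin r → κ → K[X])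
    (w : Fin r → μ → K[X]) (ρ : Fin r) (a : ι) (b : κ) (c : μ) :
    patternVal (trailingPattern u v w) ρ a b c = (u ρ a * v ρ b * w ρ c).trailingDegree := by
  rw [trailingDegree_mul, trailingDegree_mul]
  rfl

/-- If the minimal order `m` in a cell is attained by a unique term, the `εᵐ`-coefficient of the
cell sum is the (non-zero) trailing coefficient of that term. [folklore] -/
theorem coeff_sum_ne_zero_of_unique_min [NoZeroDivisors K] (u : Fin r → ι → K[X])
    (v : Fin r → κ → K[X]) (w : Fin r → μ → K[X]) {a : ι} {b : κ} {c : μ} {m : ℕ} {ρ₀ : Fin r}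
    (hρ₀ : patternVal (trailingPattern u v w) ρ₀ a b c = m)
    (huniq : ∀ ρ, ρ ≠ ρ₀ → (m : ℕ∞) < patternVal (trailingPattern u v w) ρ a b c) :
    (∑ ρ, u ρ a * v ρ b * w ρ c).coeff m ≠ 0 := by
  rw [finsetSum_coeff, Finset.sum_eq_single ρ₀]
  · -- the `ρ₀` term: trailing degree `m`, so the coefficient is the trailing coefficient
    rw [patternVal_trailingPattern] at hρ₀
    set f := u ρ₀ a * v ρ₀ b * w ρ₀ c with hf
    have hf0 : f ≠ 0 := by
      intro h0
      rw [h0, trailingDegree_zero] at hρ₀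
      exact ENat.top_ne_coe m hρ₀
    have hnat : f.natTrailingDegree = m :=
      (trailingDegree_eq_iff_natTrailingDegree_eq hf0).1 hρ₀
    rw [← hnat]
    exact trailingCoeff_nonzero_iff_nonzero.2 hf0
  · intro ρ _ hρ
    exact coeff_eq_zero_of_lt_trailingDegree (by rw [← patternVal_trailingPattern]; exact huniq ρ hρ)
  · intro h
    exact absurd (Finset.mem_univ ρ₀) h

/-- If every term has order `> m` in a cell, the `εᵐ`-coefficient of the cell sum vanishes. [folklore] -/
theorem coeff_sum_eq_zero_of_lt [NoZeroDivisors K] (u : Fin r → ι → K[X]) (v : Fin r → κ → K[X])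
    (w : Fin r → μ → K[X]) {a : ι} {b : κ} {c : μ} {m : ℕ}
    (hlt : ∀ ρ, (m : ℕ∞) < patternVal (trailingPattern u v w) ρ a b c) :
    (∑ ρ, u ρ a * v ρ b * w ρ c).coeff m = 0 := by
  rw [finsetSum_coeff]
  refine Finset.sum_eq_zero fun ρ _ => coeff_eq_zero_of_lt_trailingDegree ?_
  rw [← patternVal_trailingPattern]
  exact hlt ρ

/-- **Tropical Brent conditions are necessary** (the route's support item `TropicalBrentNecessary`;
Maclagan–Sturmfels Thm. 3.1.3, elementary inclusion `V(f) ⊆ trop(f)`, applied cellwise to the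
Brent equations): over a commutative semiring without zero divisors, the trailing pattern of every
order-`h` approximate decomposition of `t` is a tropical Brent pattern. Proof: if the minimum `m` in
a cell were attained only once, the `εᵐ`-coefficient of the cell sum would be a non-zero trailing
coefficient, contradicting `coeff m = 0` (`m < h`) or `coeff h = t_{abc} = 0`; and if all orders
exceeded `h` the `εʰ`-coefficient would vanish, contradicting `t_{abc} ≠ 0`.
[cite: MaclaganSturmfels2015, Thm. 3.1.3] -/
theorem IsApproxDecomposition.isTropicalBrentPattern [NoZeroDivisors K] {h : ℕ}
    {t : ι → κ → μ → K} {u : Fin r → ι → K[X]} {v : Fin r → κ → K[X]} {w : Fin r → μ → K[X]}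
    (hd : IsApproxDecomposition h t u v w) :
    IsTropicalBrentPattern h t (trailingPattern u v w) := by
  intro a b c
  set W := trailingPattern u v w with hW
  constructor
  · -- (i) the minimum below `h` (or at `h` with `t = 0`) is attained twice
    intro hm
    -- the minimum is finite, hence `r ≠ 0` and it is attained
    have hfin : patternMin W a b c ≠ ⊤ := by
      rcases hm with hm | ⟨hm, -⟩
      · exact (hm.trans_le le_top).ne
      · rw [hm]; exact ENat.coe_ne_top h
    obtain ⟨m, hmeq⟩ : ∃ m : ℕ, patternMin W a b c = m := ENat.ne_top_iff_exists.1 hfin |>.imp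
      fun m hm' => hm'.symm
    have hr : r ≠ 0 := by
      rintro rfl
      simp [patternMin] at hmeq
    haveI : NeZero r := ⟨hr⟩
    obtain ⟨ρ₀, hρ₀⟩ := exists_patternVal_eq_patternMin W a b c
    by_contra hcon
    push Not at hcon
    -- uniqueness of the minimiser
    have huniq : ∀ ρ, ρ ≠ ρ₀ → (m : ℕ∞) < patternVal W ρ a b c := by
      intro ρ hρ
      refine lt_of_le_of_ne (hmeq ▸ patternMin_le W ρ a b c) fun heq' => ?_
      exact hcon ρ ρ₀ hρ (by rw [← heq', hmeq]) hρ₀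
    have hne := coeff_sum_ne_zero_of_unique_min u v w (hρ₀.trans hmeq) huniq
    -- but the Brent equation kills this coefficient
    have hmle : m ≤ h := by
      rcases hm with hm | ⟨hm, -⟩
      · rw [hmeq] at hm; exact_mod_cast hm.le
      · rw [hmeq] at hm; exact_mod_cast hm.le
    have hcoeff := hd a b c m hmle
    rcases hm with hm | ⟨hm, ht⟩
    · rw [hmeq] at hm
      have hmh : m ≠ h := by exact_mod_cast hm.ne
      rw [if_neg hmh] at hcoeff
      exact hne hcoeff
    · rw [hmeq] at hm
      have hmh : m = h := by exact_mod_cast hm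
      rw [if_pos hmh, ht] at hcoeff
      exact hne hcoeff
  · -- (ii) a non-zero right-hand side forces some term of order `≤ h`
    intro ht
    by_contra hgt
    push Not at hgt
    have hlt : ∀ ρ, (h : ℕ∞) < patternVal W ρ a b c := fun ρ => hgt.trans_le (patternMin_le W ρ a b c)
    have h0 := coeff_sum_eq_zero_of_lt u v w hlt
    have hcoeff := hd a b c h le_rfl
    rw [if_pos rfl] at hcoeff
    exact ht (hcoeff ▸ h0)

end Necessary

end Literature.Computability.AlgebraicComplexity

end
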